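import Literature.NumberTheory.Weil1964.ArchFollandHermiteSplit
import Summits.HodgeConjecture.HodgeConjecture.Theorems.F0LD1ThetaClassHermiteSum
import HarnessLib

/-!
# Pure tensors are dense in the archimedean Schwartz space `𝓢((F ⊗ ℝ)^{ι₁ ⊕ ι₂})` (`F` totally real) — organ (O45ii-arch) of socket #45D
# `sig_K2LiuDoublingPairingTensorSeparation` (`K2/K2Liu-p03/g3`)

Track B ∕ hLiu418 = stmt-HodgeConjecture-24832, line `K2_Liu_CurveThetaSigs`, unit U6 (ED. 7), socket #45D «tensor separation for the doubling pairing»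
(LEAD F0P6-plan re-deal 2026-09-04 02:36Z); seat `hodgecm-mathlib-K2Liu-p03` (g3).  THE ARCHIMEDEAN CONTENT of (O45ii): for a totally real number field `F`
and finite index types `ι₁, ι₂`, the `ℂ`-span of the separate-variable products `archBoxTensor φ₁ φ₂ = φ₁(x) φ₂(y)` (★ `AdelicSchwartzBruhatDirectSum`) is
DENSE in `𝓢((ι₁ ⊕ ι₂ → F ⊗ ℝ), ℂ)` for the Schwartz topology — `𝓢(ℝ^a) ⊗ 𝓢(ℝ^b)` is dense in `𝓢(ℝ^{a+b})`.  Proof = the tree's `N`-representation theorem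
(every Schwartz function is the sum IN `𝓢` of its Hermite series, ★ `SegalBargmann.HermiteExpansionSchwartz` ∕ ★ `hasSum_hermiteCoeff_smul_hermitePi`
[ReedSimon I, Thm V.13]) transported along the scaled real-place frame `e_{1 ⊔ 1}` of `(ι₁ ⊕ ι₂ → F ⊗ ℝ)` (★ `scaledFrame`, ★ `follandHermite`), and the fact that
EVERY Hermite function of the juxtaposed frame is a product of two Hermite functions (★ `ArchFollandHermiteSplit.follandHermite_juxtaposed_eq_archBoxTensor`
[Folland1989, §1.7 (1.81)]): the partial sums of the Hermite series lie in the span of the pure tensors.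

* `mem_closure_span_follandHermite` — `φ ∈ closure (span {h_β ∘ e})` for any frame `e : D ≃L[ℝ] ℝ^σ` (★ `F0LD1ThetaClassHermiteSum.hasSum_follandCoeff_smul_follandHermite`);
* **`dense_span_archBoxTensor`** — `Dense (span ℂ (range fun p => archBoxTensor p.1 p.2))` in `𝓢((ι₁ ⊕ ι₂ → F ⊗ ℝ), ℂ)` — the hypothesis `hD` of ★
  `K2LiuPureTensorWitness.exists_sumTensor_ne_zero`. [cite: ReedSimonI1980, Thm. V.13] [cite: Folland1989, §1.7 (1.81)] [cite: Treves1967, Thm. 51.6]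

No definition, no instance, no named fact, no `sorry`; axioms ⊆ {propext, Classical.choice, Quot.sound}.

## References
* [ReedSimonI1980] M. Reed, B. Simon, *Methods of Modern Mathematical Physics I*, Academic Press (1980), Thm. V.13 and App. to §V.3.
* [Folland1989] G. B. Folland, *Harmonic Analysis in Phase Space*, Princeton UP (1989), §1.7 (1.81).
* [Treves1967] F. Trèves, *Topological Vector Spaces, Distributions and Kernels*, Academic Press (1967), Thm. 51.6 p. 530.

HONEST LABEL: HC_CM is proved only modulo the 7 printed citations (2 remaining named inputs: hLiu418 = stmt-HodgeConjecture-24832, h413 =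
stmt-HodgeConjecture-24833) until rung 0 closes; this helper moves no counter.
-/

set_option autoImplicit false

set_option linter.dupNamespace false

noncomputable section

open NumberField NumberField.InfinitePlace NumberField.mixedEmbedding Filter Topology Set
open Literature.Analysis.SegalBargmann Literature.NumberTheory.Automorphic Literature.NumberTheory.Weil1964
open scoped SchwartzMap Classical

namespace Summit.HodgeConjecture.HodgeConjecture.Cruxes.HLiu418.K2LiuArchSchwartzTensorDense

open Summit.HodgeConjecture.HodgeConjecture.Cruxes.HLiu418

/-! ## §1 The Hermite expansion along a frame -/

section Frame

variable {σ : Type*} [Fintype σ] [DecidableEq σ] {D : Type*} [NormedAddCommGroup D] [NormedSpace ℝ D]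

/-- **`φ` lies in the closure of the span of the Hermite functions `h_β ∘ e` of any frame `e : D ≃L[ℝ] ℝ^σ`** (the Hermite series of `φ` converges to `φ`
IN `𝓢(D, ℂ)`: ★ `F0LD1ThetaClassHermiteSum.hasSum_follandCoeff_smul_follandHermite`, the transport of ★ `hasSum_hermiteCoeff_smul_hermitePi`).
[cite: ReedSimonI1980, Thm. V.13] [cite: Folland1989, §1.7] -/
theorem mem_closure_span_follandHermite (e : D ≃L[ℝ] (σ → ℝ)) (φ : 𝓢(D, ℂ)) :
    φ ∈ closure ((Submodule.span ℂ (Set.range fun β : σ →₀ ℕ => follandHermite e β) : Submodule ℂ 𝓢(D, ℂ)) : Set 𝓢(D, ℂ)) :=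
  mem_closure_of_tendsto (F0LD1ThetaClassHermiteSum.hasSum_follandCoeff_smul_follandHermite e φ) (Eventually.of_forall fun _ =>
    SetLike.mem_coe.mpr (Submodule.sum_mem _ fun β _ => Submodule.smul_mem _ _ (Submodule.subset_span ⟨β, rfl⟩)))

end Frame

/-! ## §2 Density of the pure tensors -/

section Dense

variable (F : Type) [Field F] [NumberField F] [IsTotallyReal F] (ι₁ ι₂ : Type) [Fintype ι₁] [Fintype ι₂]

/-- **PURE TENSORS ARE DENSE IN `𝓢((F ⊗ ℝ)^{ι₁ ⊕ ι₂})`** (`F` totally real): the `ℂ`-span of the separate-variable products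
`archBoxTensor φ₁ φ₂` is dense for the Schwartz topology — every `φ` is the Schwartz-limit of the partial sums of its Hermite series in the juxtaposed frame
`e_{1 ⊔ 1}`, and every Hermite function of that frame is an `archBoxTensor` of two Hermite functions (★ `follandHermite_juxtaposed_eq_archBoxTensor`).
[cite: ReedSimonI1980, Thm. V.13] [cite: Folland1989, §1.7 (1.81)] [cite: Treves1967, Thm. 51.6 p. 530] -/
theorem dense_span_archBoxTensor :
    Dense ((Submodule.span ℂ (Set.range fun p : 𝓢((ι₁ → mixedSpace F), ℂ) × 𝓢((ι₂ → mixedSpace F), ℂ) =>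
      archBoxTensor p.1 p.2) : Submodule ℂ 𝓢((ι₁ ⊕ ι₂ → mixedSpace F), ℂ)) : Set 𝓢((ι₁ ⊕ ι₂ → mixedSpace F), ℂ)) := by
  -- the juxtaposed unit frame `e_{1 ⊔ 1}` on `(ι₁ ⊕ ι₂ → F ⊗ ℝ)`
  have hD : ∀ k : (ι₁ ⊕ ι₂) × {v : InfinitePlace F // v.IsReal},
      Sum.elim (fun i : ι₁ => (fun _ : ι₁ × {v : InfinitePlace F // v.IsReal} => (1 : ℝ)) (i, k.2))
        (fun j : ι₂ => (fun _ : ι₂ × {v : InfinitePlace F // v.IsReal} => (1 : ℝ)) (j, k.2)) k.1 ≠ 0 := by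
    rintro ⟨i | j, v⟩ <;> simp
  intro φ
  refine closure_mono (SetLike.coe_subset_coe.mpr (Submodule.span_le.mpr ?_))
    (mem_closure_span_follandHermite (scaledFrame F (ι₁ ⊕ ι₂) _ hD) φ)
  rintro _ ⟨γ, rfl⟩
  exact Submodule.subset_span ⟨(_, _), (follandHermite_juxtaposed_eq_archBoxTensor (F := F) (fun _ => (1 : ℝ)) (fun _ => one_ne_zero)
    (fun _ => (1 : ℝ)) (fun _ => one_ne_zero) hD γ).symm⟩

end Dense

end Summit.HodgeConjecture.HodgeConjecture.Cruxes.HLiu418.K2LiuArchSchwartzTensorDense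

end
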